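import Summits.CriticalPhenomena.PercolationContinuityZ3.Theorems.PercNearOneGluingNoHeavyPcintUFibZ8Rows1
import HarnessLib

/-!
# PCINT lane, T-fibre route PHASE 2, instance `d = 8`: `p_c^site(ℤ^8) ≤ 0.2252` via `𝕋 × K_{10,10}`

Cell `prim-pcint`, seat `prim-pcint-1` (gen 12); memo `run/shared/lean/prim/pcint/T-FIBRE-ROUTE.md` (PHASE 2).

The fibre graph is the complete bipartite graph `K_{10,10} = Cay(ℤ_{20}, odd residues)` realised as
`UFib.bipGraph (evens20)` on `ZMod 20`; the linear map `ℤ^8 → ℤ² × ZMod 20`,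
`z ↦ ((z₀ + z₂, z₁ − z₂), Σ_t (2t+1)·z_{3+t} mod 20)`, sends the `16` neighbours of `z` ONTO the neighbours of its image
(`±e₀, ±e₁, ±e₂ ↦` the six directions of `𝕋`; `±e_{3+t} ↦ ±(2t+1)`, and the odd residues mod `20` are exactly
`{±1, ±3, …, ±9}`), so `p_c^site(ℤ^8) ≤ p_c^site(𝕋 × K_{10,10})` (Lyons–Peres Thm. 6.47, site version, as in
`…PcintTFibGraph.lean`).  The usable-set comparison (`UFib.siteCriticalProb_lfib_le_of_table` with the sound rule
`UFib.bipRule` and the kernel-checked table `UFib.checkBip 10 10 (2252/10000) (5001/10000)`) gives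
`p_c^site(𝕋 × K_{10,10}) ≤ 0.2252`, hence **`UFib.siteCriticalProb_Z8_le_2252` : `p_c^site(ℤ^8) ≤ 0.2252`** and the
monotone-in-`d` version.
-/

noncomputable section

namespace Summit.CriticalPhenomena.PercolationContinuityZ3.Theorems.Pcint

namespace UFib

open Finset AdaptDom TFib Literature.Probability.Percolation Literature.Probability.LatticeModels
  LyonsPeres647Multi LyonsPeres647Site

/-! ### The fibre `K_{10,10}` on `ZMod 20` -/

/-- The even residues of `ZMod 20` (one side of `K_{10,10}`). -/
def evens20 : Finset (ZMod 20) := univ.filter fun c => c.val % 2 = 0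

/-- The neighbours of a cell in `K_{10,10} = Cay(ℤ_{20}, odd)` are its translates by the odd residues `±1, ±3, …`. -/
theorem bipGraph_evens20_adj {i j : ZMod 20} (h : (bipGraph evens20).Adj i j) :
    j = i + 1 ∨ j = i - 1 ∨ j = i + 3 ∨ j = i - 3 ∨ j = i + 5 ∨ j = i - 5 ∨ j = i + 7 ∨ j = i - 7 ∨ j = i + 9 ∨ j = i - 9 := by
  revert i j h; decide

/-- `#evens20 = 10`. -/
theorem card_evens20 : (evens20).card = 10 := by decide

/-- `#(evens20)ᶜ = 10`. -/
theorem card_evens20_compl : (evens20)ᶜ.card = 10 := by decide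

/-- `0` is even and `1` is odd in `ZMod 20`. -/
theorem zero_mem_evens20 : (0 : ZMod 20) ∈ evens20 ∧ (1 : ZMod 20) ∉ evens20 := by decide

/-- The sound usable-set rule of `K_{10,10}` with root cell `0`. -/
def rule20 : RuleData (bipGraph evens20) := bipRule evens20 0 zero_mem_evens20.1 1 zero_mem_evens20.2

/-! ### The covering `ℤ^8 → 𝕋 × K_{10,10}` -/

/-- **The projection `ℤ^8 → 𝕋 × K_{10,10}` is a weak covering map**: the `16` neighbours of `x` are mapped onto the
neighbours of its image. [cite: LyonsPeres2016, §6.9 Thm. 6.47 (weak covering map hypothesis)] -/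
theorem surjOn_neighborSet_proj8 (x : Site 8) :
    Set.SurjOn (fun z : Site 8 => ((![z 0 + z 2, z 1 - z 2] : Site 2), ((z 3 : ℤ) : ZMod 20) + 3 * ((z 4 : ℤ) : ZMod 20) + 5 * ((z 5 : ℤ) : ZMod 20) + 7 * ((z 6 : ℤ) : ZMod 20) + 9 * ((z 7 : ℤ) : ZMod 20)))
      ((zdGraph 8).neighborSet x)
      ((lfib (bipGraph evens20)).neighborSet ((![x 0 + x 2, x 1 - x 2] : Site 2), ((x 3 : ℤ) : ZMod 20) + 3 * ((x 4 : ℤ) : ZMod 20) + 5 * ((x 5 : ℤ) : ZMod 20) + 7 * ((x 6 : ℤ) : ZMod 20) + 9 * ((x 7 : ℤ) : ZMod 20))) := by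
  intro yj hy
  obtain ⟨y, j⟩ := yj
  rw [SimpleGraph.mem_neighborSet, lfib_adj] at hy
  have hplus := add_single_mem_neighborSet x
  have hminus := sub_single_mem_neighborSet x
  have hy_of : ∀ z : Site 8, z 0 + z 2 = y 0 → z 1 - z 2 = y 1 → ((z 3 : ℤ) : ZMod 20) + 3 * ((z 4 : ℤ) : ZMod 20) + 5 * ((z 5 : ℤ) : ZMod 20) + 7 * ((z 6 : ℤ) : ZMod 20) + 9 * ((z 7 : ℤ) : ZMod 20) = j →
      (fun z : Site 8 => ((![z 0 + z 2, z 1 - z 2] : Site 2), ((z 3 : ℤ) : ZMod 20) + 3 * ((z 4 : ℤ) : ZMod 20) + 5 * ((z 5 : ℤ) : ZMod 20) + 7 * ((z 6 : ℤ) : ZMod 20) + 9 * ((z 7 : ℤ) : ZMod 20))) z = (y, j) := by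
    intro z h0 h1 h3
    simp only [Prod.mk.injEq]
    refine ⟨?_, h3⟩
    ext i; fin_cases i
    · simpa using h0
    · simpa using h1
  rcases hy with ⟨hadj, hj⟩ | ⟨heq, hj⟩
  · -- planar move, same fibre coordinate
    simp only at hadj hj
    have hd := diff_of_triGraph_adj hadj
    simp only [Matrix.cons_val_zero, Matrix.cons_val_one] at hd
    rcases hd with ⟨h0, h1⟩ | ⟨h0, h1⟩ | ⟨h0, h1⟩ | ⟨h0, h1⟩ | ⟨h0, h1⟩ | ⟨h0, h1⟩
    · exact ⟨x + Pi.single 0 1, hplus 0, hy_of _ (by simp; omega) (by simp; omega) (by simpa using hj)⟩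
    · exact ⟨x - Pi.single 0 1, hminus 0, hy_of _ (by simp; omega) (by simp; omega) (by simpa using hj)⟩
    · exact ⟨x + Pi.single 1 1, hplus 1, hy_of _ (by simp; omega) (by simp; omega) (by simpa using hj)⟩
    · exact ⟨x - Pi.single 1 1, hminus 1, hy_of _ (by simp; omega) (by simp; omega) (by simpa using hj)⟩
    · exact ⟨x + Pi.single 2 1, hplus 2, hy_of _ (by simp; omega) (by simp; omega) (by simpa using hj)⟩
    · exact ⟨x - Pi.single 2 1, hminus 2, hy_of _ (by simp; omega) (by simp; omega) (by simpa using hj)⟩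
  · -- fibre move, same planar point
    simp only at heq hj
    have h0 : x 0 + x 2 = y 0 := by have := congrFun heq 0; simpa using this
    have h1 : x 1 - x 2 = y 1 := by have := congrFun heq 1; simpa using this
    rcases bipGraph_evens20_adj hj with hj' | hj' | hj' | hj' | hj' | hj' | hj' | hj' | hj' | hj'
    · exact ⟨x + Pi.single 3 1, hplus 3, hy_of _ (by simp; omega) (by simp; omega) (by simp [hj']; ring)⟩
    · exact ⟨x - Pi.single 3 1, hminus 3, hy_of _ (by simp; omega) (by simp; omega) (by simp [hj']; ring)⟩
    · exact ⟨x + Pi.single 4 1, hplus 4, hy_of _ (by simp; omega) (by simp; omega) (by simp [hj']; ring)⟩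
    · exact ⟨x - Pi.single 4 1, hminus 4, hy_of _ (by simp; omega) (by simp; omega) (by simp [hj']; ring)⟩
    · exact ⟨x + Pi.single 5 1, hplus 5, hy_of _ (by simp; omega) (by simp; omega) (by simp [hj']; ring)⟩
    · exact ⟨x - Pi.single 5 1, hminus 5, hy_of _ (by simp; omega) (by simp; omega) (by simp [hj']; ring)⟩
    · exact ⟨x + Pi.single 6 1, hplus 6, hy_of _ (by simp; omega) (by simp; omega) (by simp [hj']; ring)⟩
    · exact ⟨x - Pi.single 6 1, hminus 6, hy_of _ (by simp; omega) (by simp; omega) (by simp [hj']; ring)⟩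
    · exact ⟨x + Pi.single 7 1, hplus 7, hy_of _ (by simp; omega) (by simp; omega) (by simp [hj']; ring)⟩
    · exact ⟨x - Pi.single 7 1, hminus 7, hy_of _ (by simp; omega) (by simp; omega) (by simp [hj']; ring)⟩

/-- The projection `ℤ^8 → 𝕋 × K_{10,10}` has the `1`-fold lifting property. [cite: LyonsPeres2016, §6.9 Thm. 6.47 (weak covering map)] -/
theorem multiLift_proj8 :
    MultiLift (zdGraph 8) (lfib (bipGraph evens20))
      (fun z : Site 8 => ((![z 0 + z 2, z 1 - z 2] : Site 2), ((z 3 : ℤ) : ZMod 20) + 3 * ((z 4 : ℤ) : ZMod 20) + 5 * ((z 5 : ℤ) : ZMod 20) + 7 * ((z 6 : ℤ) : ZMod 20) + 9 * ((z 7 : ℤ) : ZMod 20))) 1 :=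
  AxisGrouping.multiLift_one_of_surjOn surjOn_neighborSet_proj8

/-- **`p_c^site(ℤ^8) ≤ p_c^site(𝕋 × K_{10,10})`** (site covering theorem). [cite: LyonsPeres2016, §6.9 Thm. 6.47 (site version)] -/
theorem siteCriticalProb_Z8_le_lfib :
    siteCriticalProb (zdGraph 8) (0 : Site 8) ≤ siteCriticalProb (lfib (bipGraph evens20)) ((0 : Site 2), (0 : ZMod 20)) := by
  have h0 : ((![(0 : Site 8) 0 + (0 : Site 8) 2, (0 : Site 8) 1 - (0 : Site 8) 2] : Site 2),
      ((( 0 : Site 8) 3 : ℤ) : ZMod 20) + 3 * (((0 : Site 8) 4 : ℤ) : ZMod 20) + 5 * (((0 : Site 8) 5 : ℤ) : ZMod 20) + 7 * (((0 : Site 8) 6 : ℤ) : ZMod 20) + 9 * (((0 : Site 8) 7 : ℤ) : ZMod 20)) = ((0 : Site 2), (0 : ZMod 20)) := by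
    simp only [Prod.mk.injEq]
    refine ⟨?_, by simp⟩
    ext i; fin_cases i <;> simp
  refine le_of_forall_gt_imp_ge_of_dense fun t ht => ?_
  by_cases ht1 : t ≤ 1
  · have ht0 : 0 ≤ t := (siteCriticalProb_mem_Icc (lfib (bipGraph evens20)) ((0 : Site 2), (0 : ZMod 20))).1.trans ht.le
    exact siteCriticalProb_le_of_multiLift (zdGraph 8) (lfib (bipGraph evens20)) _ 1 multiLift_proj8 0 ⟨t, ht0, ht1⟩
      (by rw [h0, StarCoins.coe_orParam]; simpa using ht)
  · exact (siteCriticalProb_mem_Icc _ _).2.trans (le_of_not_ge ht1)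

/-! ### The table and the cell -/



-- the table `checkBip_8` is assembled in `…PcintUFibZ8Rows1.lean`

/-- **`p_c^site(𝕋 × K_{10,10}) ≤ 0.2252`.** -/
theorem siteCriticalProb_lfib8_le :
    siteCriticalProb (lfib (bipGraph evens20)) ((0 : Site 2), (0 : ZMod 20)) ≤ 2252 / 10000 := by
  have hchk : checkBip (evens20).card (evens20)ᶜ.card ((2252 : ℚ) / 10000) (5001 / 10000) = true := by
    rw [card_evens20, card_evens20_compl]; exact checkBip_8
  have htab := table_of_checkBip evens20 hchk
  have hp : ((((2252 : ℚ) / 10000 : ℚ) : ℝ)) = (2252 : ℝ) / 10000 := by push_cast; ring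
  have hs : ((((5001 : ℚ) / 10000 : ℚ) : ℝ)) = (5001 : ℝ) / 10000 := by push_cast; ring
  rw [hp, hs] at htab
  have h := siteCriticalProb_lfib_le_of_table rule20 ((2252 : ℝ) / 10000) ((5001 : ℝ) / 10000)
    (by norm_num) (by norm_num) (by norm_num) (by norm_num)
    (by rw [ZMod.card]; norm_num) htab
  simpa [rule20] using h

/-- **`p_c^site(ℤ^8) ≤ 0.2252`** (usable-set T-fibre comparison with complete bipartite fibres `K_{10,10}`). -/
theorem siteCriticalProb_Z8_le_2252 : siteCriticalProb (zdGraph 8) (0 : Site 8) ≤ 0.2252 :=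
  siteCriticalProb_Z8_le_lfib.trans (siteCriticalProb_lfib8_le.trans (by norm_num))

/-- **`p_c^site(ℤ^d) ≤ 0.2252` for every `d ≥ 8`.** -/
theorem siteCriticalProb_zd_le_2252 {d : ℕ} (hd : 8 ≤ d) : siteCriticalProb (zdGraph d) (0 : Site d) ≤ 0.2252 :=
  (AxisGrouping.siteCriticalProb_zd_anti hd).trans siteCriticalProb_Z8_le_2252

end UFib

end Summit.CriticalPhenomena.PercolationContinuityZ3.Theorems.Pcint

end
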